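import Mathlib
import Summits.Ventures.PercRepro.TriangleCapThreeTrianglesB

/-!
# PercRepro — THREE TRIANGLES, ONE SHARED VERTEX: THE `r = 2` CELL FOR EVERY `k ≥ 9` (p3, gen 37; part 63)

`T₁ ∩ T₂ = {t}`, `T₃` disjoint from `T₁ ∪ T₂`; `S = T₁ ∪ T₂ ∪ T₃`, `|S| = 8`: `degIn S t ≤ 5`, `degIn S ≤ 3` on
`(T₁ ∪ T₂) ∖ {t}`, `≤ 4` on `T₃`, so `18 ≤ Q ≤ 29` and `Σ_{T₁} + Σ_{T₂} + Σ_{T₃} degIn S = Q + degIn S t ≤ Q + 5`;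
off `S`, `degIn S z ≤ 3` and `W(z) ≤ 3 degIn S z + 1 + 2 [z ~ t]`.  The far count of TriangleCapThreeTrianglesA
gives `Σ_p deficit(p) ≥ 142 − 4Q + |Sᶜ| (Q − 12) ≥ 4k + 6` for `k ≥ 9`.

* `eq_of_degIn_le_one` — a vertex with at most one neighbour in `T'` and a neighbour `t ∈ T'` has no other;
* **`four_mul_card_add_six_le_sum_deficit_of_one_shared`** — the far count for `k ≥ 9`;
* **`three_triangles_stability_two_of_one_shared`** — the `r = 2` stability, `k ≥ 9`.
Axioms: standard.
-/

namespace PercRepro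

namespace TriangleCap

namespace C047

open Finset

variable {V : Type*} [Fintype V] [DecidableEq V]

omit [Fintype V] in
/-- In a three-clique `T`, a vertex `x ∈ T` with `degIn T' x ≤ 1` for a second clique `T'` through a vertex
`t ∈ T`, `t ≠ x`, has no neighbour in `T' ∖ {t}`: `degIn (T ∪ T') x ≤ 2`. -/
theorem degIn_union_le_two_of_shared (D : SimpleGraph V) [DecidableRel D.Adj] {T T' : Finset V} (hT : T.card = 3)
    (hcl : ∀ x ∈ T, ∀ y ∈ T, x ≠ y → D.Adj x y) {t x : V} (ht : t ∈ T) (ht' : t ∈ T') (hx : x ∈ T) (hxt : x ≠ t)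
    (hone : degIn D T' x ≤ 1) : degIn D (T ∪ T') x ≤ 2 := by
  have hsub : (T ∪ T').filter (fun y => D.Adj x y) ⊆ T.filter (fun y => D.Adj x y) := by
    intro y hy
    rw [mem_filter, mem_union] at hy
    rw [mem_filter]
    refine ⟨?_, hy.2⟩
    rcases hy.1 with h | h
    · exact h
    · unfold degIn at hone
      have := card_le_one.mp hone y (mem_filter.mpr ⟨h, hy.2⟩) t (mem_filter.mpr ⟨ht', hcl x hx t ht hxt⟩)
      rw [this]; exact ht
  have := card_le_card hsub
  have h2 := degIn_le_two_of_mem D hT hx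
  unfold degIn at h2 ⊢
  omega

omit [Fintype V] [DecidableEq V] in
/-- A vertex `x ∉ T'` with `degIn T' x ≤ 1` and a neighbour `t ∈ T'` has no other neighbour in `T'`. -/
theorem eq_of_degIn_le_one (D : SimpleGraph V) [DecidableRel D.Adj] {T' : Finset V} {x t y : V}
    (hone : degIn D T' x ≤ 1) (ht : t ∈ T') (hxt : D.Adj x t) (hy : y ∈ T') (hxy : D.Adj x y) : y = t := by
  unfold degIn at hone
  exact card_le_one.mp hone y (mem_filter.mpr ⟨hy, hxy⟩) t (mem_filter.mpr ⟨ht, hxt⟩)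

/-- **THE FAR COUNT FOR THREE TRIANGLES WITH ONE SHARED VERTEX:** `4k + 6 ≤ Σ_p deficit(p)` for `k ≥ 9`. -/
theorem four_mul_card_add_six_le_sum_deficit_of_one_shared (D : SimpleGraph V) [DecidableRel D.Adj]
    (T₁ T₂ T₃ : Finset V) (h₁ : T₁.card = 3) (h₂ : T₂.card = 3) (h₃ : T₃.card = 3) {t : V}
    (hint : T₁ ∩ T₂ = {t}) (h13 : Disjoint T₁ T₃) (h23 : Disjoint T₂ T₃)
    (hcl₁ : ∀ x ∈ T₁, ∀ y ∈ T₁, x ≠ y → D.Adj x y) (hcl₂ : ∀ x ∈ T₂, ∀ y ∈ T₂, x ≠ y → D.Adj x y)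
    (hcl₃ : ∀ x ∈ T₃, ∀ y ∈ T₃, x ≠ y → D.Adj x y)
    (hone₁ : ∀ z, z ∉ T₁ → degIn D T₁ z ≤ 1) (hone₂ : ∀ z, z ∉ T₂ → degIn D T₂ z ≤ 1)
    (hone₃ : ∀ z, z ∉ T₃ → degIn D T₃ z ≤ 1) (hk : 9 ≤ Fintype.card V) :
    4 * Fintype.card V + 6 ≤ ∑ p ∈ adjPairsAll D, deficit D p := by
  have hi12 : (T₁ ∩ T₂).card ≤ 1 := by rw [hint, card_singleton]
  have hi13 : (T₁ ∩ T₃).card ≤ 1 := by rw [disjoint_iff_inter_eq_empty.mp h13, card_empty]; exact Nat.zero_le _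
  have hi23 : (T₂ ∩ T₃).card ≤ 1 := by rw [disjoint_iff_inter_eq_empty.mp h23, card_empty]; exact Nat.zero_le _
  have hcount := three_triangles_far_count D T₁ T₂ T₃ h₁ h₂ h₃ hi12 hi13 hi23 hcl₁ hcl₂ hcl₃
  have ht1 : t ∈ T₁ := (mem_inter.mp (by rw [hint]; exact mem_singleton_self t)).1
  have ht2 : t ∈ T₂ := (mem_inter.mp (by rw [hint]; exact mem_singleton_self t)).2
  set S := T₁ ∪ T₂ ∪ T₃ with hS
  have hd12 : Disjoint (T₁ ∪ T₂) T₃ := disjoint_union_left.mpr ⟨h13, h23⟩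
  have h12card : (T₁ ∪ T₂).card = 5 := by
    have := card_union_add_card_inter T₁ T₂
    rw [hint, card_singleton, h₁, h₂] at this
    omega
  have hScard : S.card = 8 := by rw [hS, card_union_of_disjoint hd12, h12card, h₃]
  have hRcard : Sᶜ.card + 8 = Fintype.card V := by rw [card_compl, hScard]; omega
  have htS : t ∈ S := mem_union_left _ (mem_union_left _ ht1)
  -- the degrees into `S`
  have hsplit : ∀ x, degIn D S x ≤ degIn D (T₁ ∪ T₂) x + degIn D T₃ x := fun x => by
    rw [hS]; exact degIn_union_le D (T₁ ∪ T₂) T₃ x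
  have hside : ∀ x ∈ T₁ ∪ T₂, x ≠ t → (x ∈ T₁ ∧ x ∉ T₂) ∨ (x ∈ T₂ ∧ x ∉ T₁) := by
    intro x hx hxt
    rw [mem_union] at hx
    have hnot : ¬ (x ∈ T₁ ∧ x ∈ T₂) := fun h => by
      have : x ∈ T₁ ∩ T₂ := mem_inter.mpr h
      rw [hint, mem_singleton] at this
      exact hxt this
    rcases hx with hx | hx
    · exact Or.inl ⟨hx, fun h => hnot ⟨hx, h⟩⟩
    · exact Or.inr ⟨hx, fun h => hnot ⟨h, hx⟩⟩
  have hcr_t : degIn D S t ≤ 5 := by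
    have h1 := hsplit t
    have h2 : degIn D (T₁ ∪ T₂) t ≤ 4 := by
      have := degIn_le_card_sub_one D (mem_union_left T₂ ht1)
      rw [h12card] at this
      exact this
    have h3 := hone₃ t (fun h => disjoint_left.mp h13 ht1 h)
    omega
  have hcr_side : ∀ x ∈ T₁ ∪ T₂, x ≠ t → degIn D S x ≤ 3 := by
    intro x hx hxt
    have h1 := hsplit x
    have h3 : degIn D T₃ x ≤ 1 := by
      rw [mem_union] at hx
      rcases hx with hx | hx
      · exact hone₃ x (fun h => disjoint_left.mp h13 hx h)
      · exact hone₃ x (fun h => disjoint_left.mp h23 hx h)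
    have h2 : degIn D (T₁ ∪ T₂) x ≤ 2 := by
      rcases hside x hx hxt with ⟨hx1, hx2⟩ | ⟨hx2, hx1⟩
      · exact degIn_union_le_two_of_shared D h₁ hcl₁ ht1 ht2 hx1 hxt (hone₂ x hx2)
      · rw [union_comm]
        exact degIn_union_le_two_of_shared D h₂ hcl₂ ht2 ht1 hx2 hxt (hone₁ x hx1)
    omega
  have hcr_three : ∀ y ∈ T₃, degIn D S y ≤ 4 := by
    intro y hy
    have h1 := hsplit y
    have h2 := degIn_union_le D T₁ T₂ y
    have := degIn_le_two_of_mem D h₃ hy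
    have := hone₁ y (fun h => disjoint_left.mp h13 h hy)
    have := hone₂ y (fun h => disjoint_left.mp h23 h hy)
    omega
  have hcr_all : ∀ x ∈ S, degIn D S x ≤ 4 + (if x = t then 1 else 0) := by
    intro x hx
    by_cases hxt : x = t
    · subst hxt; simp only [if_true]; exact hcr_t
    · simp only [hxt, if_false, add_zero]
      rw [hS, mem_union] at hx
      rcases hx with hx | hx
      · have := hcr_side x hx hxt; omega
      · exact hcr_three x hx
  have hcr_ge : ∀ x ∈ S, 2 ≤ degIn D S x := by
    intro x hx
    rw [hS, mem_union, mem_union] at hx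
    rw [hS]
    rcases hx with (hx | hx) | hx
    · have h1 := degIn_left_le_union D (T₁ ∪ T₂) T₃ x
      have h2 := degIn_left_le_union D T₁ T₂ x
      rw [degIn_self_of_clique D h₁ hcl₁ hx] at h2
      omega
    · have h1 := degIn_left_le_union D (T₁ ∪ T₂) T₃ x
      have h2 := degIn_right_le_union D T₁ T₂ x
      rw [degIn_self_of_clique D h₂ hcl₂ hx] at h2
      omega
    · have h1 := degIn_right_le_union D (T₁ ∪ T₂) T₃ x
      rw [degIn_self_of_clique D h₃ hcl₃ hx] at h1
      exact h1
  -- `Q ≤ 29`, `Q ≥ 18`, and the triangle sums `≤ Q + 5`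
  have hsumS : ∀ (f : V → ℕ), ∑ x ∈ S, f x = f t + ∑ x ∈ S.erase t, f x := fun f =>
    (add_sum_erase S f htS).symm
  have hQle : adjPairs D S ≤ 29 := by
    have e : adjPairs D S = ∑ x ∈ T₁ ∪ T₂, degIn D S x + ∑ x ∈ T₃, degIn D S x := by
      rw [adjPairs_eq_sum_degIn, hS, sum_union hd12]
    have e1 : ∑ x ∈ T₁ ∪ T₂, degIn D S x = degIn D S t + ∑ x ∈ (T₁ ∪ T₂).erase t, degIn D S x :=
      (add_sum_erase _ _ (mem_union_left T₂ ht1)).symm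
    have l1 : ∑ x ∈ (T₁ ∪ T₂).erase t, degIn D S x ≤ ∑ _x ∈ (T₁ ∪ T₂).erase t, 3 :=
      sum_le_sum (fun x hx => hcr_side x (mem_of_mem_erase hx) (ne_of_mem_erase hx))
    have l2 : ∑ x ∈ T₃, degIn D S x ≤ ∑ _x ∈ T₃, 4 := sum_le_sum hcr_three
    rw [sum_const, card_erase_of_mem (mem_union_left T₂ ht1), h12card, smul_eq_mul] at l1
    rw [sum_const, h₃, smul_eq_mul] at l2
    omega
  have hQge : 18 ≤ adjPairs D S := by
    rw [adjPairs_eq_sum_degIn, hsumS]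
    have h4 : 4 ≤ degIn D S t := by
      have h1 : degIn D (T₁ ∪ T₂) t ≤ degIn D S t := by rw [hS]; exact degIn_left_le_union D _ _ t
      -- `T₁ ∖ t ∪ T₂ ∖ t ⊆ N(t) ∩ (T₁ ∪ T₂)`
      have hsub : (T₁.erase t ∪ T₂.erase t) ⊆ (T₁ ∪ T₂).filter (fun y => D.Adj t y) := by
        intro y hy
        rw [mem_union, mem_erase, mem_erase] at hy
        rw [mem_filter]
        rcases hy with ⟨hyt, hy⟩ | ⟨hyt, hy⟩
        · exact ⟨mem_union_left _ hy, hcl₁ t ht1 y hy (Ne.symm hyt)⟩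
        · exact ⟨mem_union_right _ hy, hcl₂ t ht2 y hy (Ne.symm hyt)⟩
      have hdisj : Disjoint (T₁.erase t) (T₂.erase t) := by
        rw [disjoint_left]
        intro y hy1 hy2
        rw [mem_erase] at hy1 hy2
        have : y ∈ T₁ ∩ T₂ := mem_inter.mpr ⟨hy1.2, hy2.2⟩
        rw [hint, mem_singleton] at this
        exact hy1.1 this
      have := card_le_card hsub
      rw [card_union_of_disjoint hdisj, card_erase_of_mem ht1, card_erase_of_mem ht2, h₁, h₂] at this
      have h1' : ((T₁ ∪ T₂).filter (fun y => D.Adj t y)).card ≤ degIn D S t := h1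
      omega
    have hge : ∑ x ∈ S.erase t, 2 ≤ ∑ x ∈ S.erase t, degIn D S x :=
      sum_le_sum (fun x hx => hcr_ge x (mem_of_mem_erase hx))
    rw [sum_const, card_erase_of_mem htS, hScard, smul_eq_mul] at hge
    omega
  have hA : ∑ x ∈ T₁, degIn D S x + ∑ x ∈ T₂, degIn D S x + ∑ x ∈ T₃, degIn D S x ≤ adjPairs D S + 5 := by
    have e : adjPairs D S = ∑ x ∈ T₁ ∪ T₂, degIn D S x + ∑ x ∈ T₃, degIn D S x := by
      rw [adjPairs_eq_sum_degIn, hS, sum_union hd12]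
    have e2 := sum_union_inter (s₁ := T₁) (s₂ := T₂) (f := degIn D S)
    rw [hint, sum_singleton] at e2
    omega
  -- off `S`: `s ≤ 3`, `W ≤ 3 s + 1 + 2 [z ~ t]`
  have hout : ∀ z ∈ Sᶜ, degIn D S z ≤ 3 := by
    intro z hz
    rw [mem_compl, hS, mem_union, mem_union, not_or, not_or] at hz
    have h := hsplit z
    have h2 := degIn_union_le D T₁ T₂ z
    have := hone₁ z hz.1.1
    have := hone₂ z hz.1.2
    have := hone₃ z hz.2
    omega
  have hW : ∀ z ∈ Sᶜ, ∑ x ∈ S.filter (fun x => D.Adj z x), degIn D S x ≤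
      3 * degIn D S z + 1 + (if D.Adj z t then 2 else 0) := by
    intro z hz
    rw [mem_compl, hS, mem_union, mem_union, not_or, not_or] at hz
    -- the neighbours of `z` in `T₃` number at most one: they pay `4`, the others `3`; `t` pays `5`
    have hpt : ∀ x ∈ S.filter (fun x => D.Adj z x),
        degIn D S x ≤ 3 + (if x ∈ T₃ then 1 else 0) + (if x = t then 2 else 0) := by
      intro x hx
      rw [mem_filter] at hx
      have h := hcr_all x hx.1
      by_cases hxt : x = t
      · subst x
        have ht3 : t ∉ T₃ := fun h' => disjoint_left.mp h13 ht1 h'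
        simp only [ht3, if_true, if_false, add_zero]
        omega
      · simp only [hxt, if_false, add_zero] at h ⊢
        by_cases hx3 : x ∈ T₃
        · simp only [hx3, if_true]; omega
        · simp only [hx3, if_false, add_zero]
          rw [hS, mem_union] at hx
          rcases hx.1 with h' | h'
          · exact hcr_side x h' hxt
          · exact absurd h' hx3
    calc ∑ x ∈ S.filter (fun x => D.Adj z x), degIn D S x ≤
        ∑ x ∈ S.filter (fun x => D.Adj z x), (3 + (if x ∈ T₃ then 1 else 0) + (if x = t then 2 else 0)) :=
          sum_le_sum hpt
      _ ≤ 3 * degIn D S z + 1 + (if D.Adj z t then 2 else 0) := by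
          rw [sum_add_distrib, sum_add_distrib, sum_const, smul_eq_mul, sum_ite_eq']
          have e1 : (∑ x ∈ S.filter (fun x => D.Adj z x), if x ∈ T₃ then 1 else 0) ≤ 1 := by
            rw [← sum_filter, filter_filter, ← card_eq_sum_ones]
            have : (S.filter (fun x => D.Adj z x ∧ x ∈ T₃)) ⊆ T₃.filter (fun x => D.Adj z x) := by
              intro x hx
              rw [mem_filter] at hx ⊢
              exact ⟨hx.2.2, hx.2.1⟩
            have := card_le_card this
            have h3 := hone₃ z hz.2
            unfold degIn at h3
            omega
          have e2 : (if t ∈ S.filter (fun x => D.Adj z x) then 2 else 0) = if D.Adj z t then 2 else 0 := by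
            simp only [mem_filter, htS, true_and]
          unfold degIn
          omega
  -- the pointwise bound off `S`: `4 W + 2 s² + 2 s d ≤ 16 s + 8 d + 12`
  have hpt : ∀ z ∈ Sᶜ, 4 * ∑ x ∈ S.filter (fun x => D.Adj z x), degIn D S x +
      2 * (degIn D S z * degIn D S z) + 2 * (degIn D S z * degIn D Sᶜ z) ≤
      16 * degIn D S z + 8 * degIn D Sᶜ z + 12 := by
    intro z hz
    have hWz := hW z hz
    have hs := hout z hz
    -- with `z ~ t` the degree into `S` is at most `2` (`t` counts for `T₁` and `T₂`)
    have hs2 : D.Adj z t → degIn D S z ≤ 2 := by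
      intro hzt
      rw [mem_compl, hS, mem_union, mem_union, not_or, not_or] at hz
      have h := hsplit z
      have h12 : degIn D (T₁ ∪ T₂) z ≤ 1 := by
        unfold degIn
        apply card_le_one.mpr
        intro p hp q hq
        rw [mem_filter] at hp hq
        have key : ∀ p ∈ T₁ ∪ T₂, D.Adj z p → p = t := by
          intro p hp hzp
          rw [mem_union] at hp
          rcases hp with hp | hp
          · have h := hone₁ z hz.1.1
            unfold degIn at h
            exact card_le_one.mp h p (mem_filter.mpr ⟨hp, hzp⟩) t (mem_filter.mpr ⟨ht1, hzt⟩)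
          · have h := hone₂ z hz.1.2
            unfold degIn at h
            exact card_le_one.mp h p (mem_filter.mpr ⟨hp, hzp⟩) t (mem_filter.mpr ⟨ht2, hzt⟩)
        rw [key p hp.1 hp.2, key q hq.1 hq.2]
      have := hone₃ z hz.2
      omega
    by_cases hzt : D.Adj z t
    · have := hs2 hzt
      simp only [hzt, if_true] at hWz
      set s := degIn D S z with hsdef
      clear_value s
      interval_cases s <;> omega
    · simp only [hzt, if_false, add_zero] at hWz
      set s := degIn D S z with hsdef
      clear_value s
      interval_cases s <;> omega
  have hptsum := sum_le_sum hpt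
  rw [sum_add_distrib, sum_add_distrib, sum_add_distrib, sum_add_distrib, ← mul_sum, ← mul_sum, ← mul_sum,
    ← mul_sum, ← mul_sum, sum_const, smul_eq_mul] at hptsum
  rw [hScard] at hcount
  have hk' : Fintype.card V = Sᶜ.card + 8 := by omega
  rw [hk']
  set Q := adjPairs D S with hQdef
  set R := Sᶜ.card with hRdef
  set Def := ∑ p ∈ adjPairsAll D, deficit D p with hDef
  clear_value Q R Def
  have hmain : R * Q + 142 ≤ Def + 4 * Q + 12 * R := by linarith
  have hR1 : 1 ≤ R := by omega
  rcases Nat.lt_or_ge R 4 with hR | hR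
  · interval_cases R <;> omega
  · obtain ⟨r, hr⟩ : ∃ r, R = r + 4 := ⟨R - 4, by omega⟩
    subst hr
    have : 18 * r ≤ r * Q := by nlinarith
    nlinarith

/-- **THE `r = 2` STABILITY FOR THREE TRIANGLES WITH ONE SHARED VERTEX, `k ≥ 9`.** -/
theorem three_triangles_stability_two_of_one_shared (D : SimpleGraph V) [DecidableRel D.Adj] (hK : K4mFree D)
    (hk : 9 ≤ Fintype.card V) (T₁ T₂ T₃ : Finset V) (h₁ : T₁.card = 3) (h₂ : T₂.card = 3) (h₃ : T₃.card = 3)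
    {t : V} (hint : T₁ ∩ T₂ = {t}) (h13 : Disjoint T₁ T₃) (h23 : Disjoint T₂ T₃)
    (hcl₁ : ∀ x ∈ T₁, ∀ y ∈ T₁, x ≠ y → D.Adj x y) (hcl₂ : ∀ x ∈ T₂, ∀ y ∈ T₂, x ≠ y → D.Adj x y)
    (hcl₃ : ∀ x ∈ T₃, ∀ y ∈ T₃, x ≠ y → D.Adj x y)
    (hone₁ : ∀ z, z ∉ T₁ → degIn D T₁ z ≤ 1) (hone₂ : ∀ z, z ∉ T₂ → degIn D T₂ z ≤ 1)
    (hone₃ : ∀ z, z ∉ T₃ → degIn D T₃ z ≤ 1)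
    (hT : ∀ x y z, D.Adj x y → D.Adj x z → D.Adj y z →
      (x ∈ T₁ ∧ y ∈ T₁) ∨ (x ∈ T₂ ∧ y ∈ T₂) ∨ (x ∈ T₃ ∧ y ∈ T₃)) :
    ∑ v, deg D v * deg D v + 2 * (Fintype.card V - 3) ≤ D.edgeFinset.card * Fintype.card V := by
  have hdef := four_mul_card_add_six_le_sum_deficit_of_one_shared D T₁ T₂ T₃ h₁ h₂ h₃ hint h13 h23
    hcl₁ hcl₂ hcl₃ hone₁ hone₂ hone₃ hk
  have h18 := card_triangles3_le_eighteen_of_three D T₁ T₂ T₃ h₁ h₂ h₃ hcl₁ hcl₂ hcl₃ hT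
    (fun x y z z' hxy hxz hyz hxz' hyz' => eq_of_common_nbr D hK hxy hxz hyz hxz' hyz')
  have hid := two_mul_sum_deg_sq_add_sum_deficit D
  have hmk : 2 * (D.edgeFinset.card * Fintype.card V) = 2 * D.edgeFinset.card * Fintype.card V := by ring
  omega

end C047

end TriangleCap

end PercRepro
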